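import Mathlib
import HarnessLib
import Summits.RiemannHypothesis.RiemannHypothesis.Theorems.IntegerScrewHarmonicTransfer
import Summits.RiemannHypothesis.RiemannHypothesis.Theorems.IntegerScrewMarkovSemigroup

/-!
# Route `IntegerScrew` — the transfer lemma FOR A FINITE MARKOV CHAIN (CONTINUUM-LIMIT 16.1 as used)

Combines the abstract transfer lemma (`IntegerScrewHarmonicTransfer`: Grönwall comparison for a non-negative
kernel row solving the forward equation) with the kernel facts for `P_t = e^{tQ}`
(`IntegerScrewMarkovSemigroup`: forward equation, `P_0 = I`, entrywise non-negativity for a Metzler `Q`):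

**If `Q_{ij} ≥ 0` for `i ≠ j`, `f(u;·)` is continuous on `[0,τ]` with `u`-derivative `f′` on `(0,τ]`, and the
generator inequality `Σ_y Q_{zy} f(u;y) − f′(u;z) ≤ β f(u;z)` holds for `u ∈ (0,τ]`, then
`Σ_y (e^{τQ})_{x₀y} f(0;y) ≤ e^{βτ} f(τ;x₀)`; and `≥ e^{−βτ} f(τ;x₀)` under the reversed inequality.**

With `f(0;·) = 𝟙[· = 1]` the left side is `P_{x₀}(X_τ = 1)`; with `f = h′` resp. `h̃` of CONTINUUM-LIMIT 16.2
and `β = ε^±_L` (16.5) this is literally the step «With 16.1 this is THEOREM C♯».  RH-free and walk-free.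
Nothing here bears on the truth of RH.  References: PIVOT-LAW §13.44, CONTINUUM-LIMIT §16.1 (rh-explicit);
M. Suzuki, J. Lond. Math. Soc. (2) 108 (2023) 1448–1487 [Suzuki2023].
-/

noncomputable section

-- D-0017: `Summit.<S>.<S>.…` is the designed namespace of a single-problem summit.
set_option linter.dupNamespace false

namespace Summit.RiemannHypothesis.RiemannHypothesis.Theorems.IntegerScrew

open NormedSpace Finset Set

variable {ι : Type*} [Fintype ι] [DecidableEq ι]

/-- **TRANSFER LEMMA for the Markov semigroup `e^{tQ}`, upper direction** (CONTINUUM-LIMIT 16.1). -/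
theorem markovTransfer_le (Q : Matrix ι ι ℝ) (hQ : ∀ i j, i ≠ j → 0 ≤ Q i j) (x₀ : ι)
    (f f' : ℝ → ι → ℝ) {τ β : ℝ} (hτ : 0 ≤ τ)
    (hfcont : ∀ y, ContinuousOn (fun u => f u y) (Icc 0 τ))
    (hfderiv : ∀ u ∈ Ioc 0 τ, ∀ y, HasDerivAt (fun u => f u y) (f' u y) u)
    (hineq : ∀ u ∈ Ioc 0 τ, ∀ z, (∑ y, Q z y * f u y) - f' u z ≤ β * f u z) :
    ∑ y, (exp (τ • Q)) x₀ y * f 0 y ≤ Real.exp (β * τ) * f τ x₀ :=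
  harmonicTransfer_le (fun s x y => (exp (s • Q)) x y) Q x₀ f f' hτ
    (fun y => exp_zero_smul_apply Q x₀ y)
    (fun _ hs y => exp_smul_apply_nonneg hQ hs.1 x₀ y)
    (fun y => (continuous_exp_smul_apply Q x₀ y).continuousOn)
    (fun s _ y => hasDerivAt_exp_smul_apply Q s x₀ y)
    hfcont hfderiv hineq

/-- **TRANSFER LEMMA for the Markov semigroup `e^{tQ}`, lower direction**. -/
theorem markovTransfer_ge (Q : Matrix ι ι ℝ) (hQ : ∀ i j, i ≠ j → 0 ≤ Q i j) (x₀ : ι)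
    (f f' : ℝ → ι → ℝ) {τ β : ℝ} (hτ : 0 ≤ τ)
    (hfcont : ∀ y, ContinuousOn (fun u => f u y) (Icc 0 τ))
    (hfderiv : ∀ u ∈ Ioc 0 τ, ∀ y, HasDerivAt (fun u => f u y) (f' u y) u)
    (hineq : ∀ u ∈ Ioc 0 τ, ∀ z, -(β * f u z) ≤ (∑ y, Q z y * f u y) - f' u z) :
    Real.exp (-(β * τ)) * f τ x₀ ≤ ∑ y, (exp (τ • Q)) x₀ y * f 0 y :=
  harmonicTransfer_ge (fun s x y => (exp (s • Q)) x y) Q x₀ f f' hτ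
    (fun y => exp_zero_smul_apply Q x₀ y)
    (fun _ hs y => exp_smul_apply_nonneg hQ hs.1 x₀ y)
    (fun y => (continuous_exp_smul_apply Q x₀ y).continuousOn)
    (fun s _ y => hasDerivAt_exp_smul_apply Q s x₀ y)
    hfcont hfderiv hineq

end Summit.RiemannHypothesis.RiemannHypothesis.Theorems.IntegerScrew

end
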